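import Mathlib
import Literature.Analysis.FluidPDE.BoltzmannGradLimitProofs
import HarnessLib

/-! # Stub `stub_transformLimit` of line `Sketch` (crux `EntropyRung.ConicalGap`, stmt-SmoothPoincare4-16589)

Pure measure theory: the monotone limit `T → ∞` in the finite Wang–Wang density transform
(arXiv:2308.06560, Prop. 2.6). For a σ-finite measure `μ`, `f, R ≥ 0` and the finite identity

  `Z := ∫ e^{-f} dμ = T⁻² ∫ e^{-f/T} dμ + ∫ R(x) k_T(f(x)) dμ(x)`  for every `T ≥ 1`,
  `k_T(t) = ∫₁^T (τ − 1) τ⁻⁴ e^{-t/τ} dτ`,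

we prove: the regularised asymptotic volume ratio `a = lim_{T→∞} (16π²T²)⁻¹ ∫ e^{-f/T} dμ ≥ 0` exists,
`R·k(f)` is integrable for the full kernel `k(t) = ∫_{(1,∞)} (τ − 1) τ⁻⁴ e^{-t/τ} dτ`, and
`Z = 16π² a + ∫ R k(f) dμ`.

How: the kernel `κ(t, τ) = (τ − 1) τ⁻⁴ e^{-t/τ}` is non-negative for `τ ≥ 1` and `≤ 2 (1 + τ²)⁻¹` for `t ≥ 0`,
hence integrable on `(1, ∞)`; so `0 ≤ k_T(t) ≤ k(t)` and `k_T(t) → k(t)` (`intervalIntegral_tendsto_integral_Ioi`).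
The core terms `∫ R k_T(f) = Z − T⁻²∫e^{-f/T} ≤ Z` are bounded, so Fatou (in the integrability form
`Literature.Analysis.FluidPDE.integrable_of_tendsto_of_integral_le`, along `T = n + 1`) makes `R k(f)` integrable
with `∫ R k(f) ≤ Z`; dominated convergence (bound `R k(f)`) then gives `∫ R k_T(f) → ∫ R k(f)` along the real
filter `T → ∞`, whence `(16π²T²)⁻¹ ∫ e^{-f/T} = (16π²)⁻¹ (Z − ∫ R k_T(f)) → a := (16π²)⁻¹ (Z − ∫ R k(f)) ≥ 0`.

Continuity of `f, R` and the integrability of the three weights are part of the registered signature but are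
not used in this step (measurability comes from the finite identity's integrability clause).
-/

noncomputable section

-- `Summit.SmoothPoincare4.SmoothPoincare4.…` (summit = problem) trips `dupNamespace` on every decl.
set_option linter.dupNamespace false

open scoped ENNReal NNReal Topology
open MeasureTheory Set Filter

namespace Summit.SmoothPoincare4.SmoothPoincare4.Theorems.ConicalGapSketch

/-- The density-transform kernel `κ(t, τ) = (τ − 1) τ⁻⁴ e^{-t/τ}` is non-negative for `τ ≥ 1`. -/
theorem transformKernel_nonneg (t : ℝ) {τ : ℝ} (hτ : 1 ≤ τ) :
    0 ≤ (τ - 1) / τ ^ 4 * Real.exp (-t / τ) :=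
  mul_nonneg (div_nonneg (by linarith) (by positivity)) (Real.exp_pos _).le

/-- For `t ≥ 0` and `τ ≥ 1`: `κ(t, τ) ≤ 2 (1 + τ²)⁻¹` (crudely, `κ ≤ (τ − 1) τ⁻⁴ ≤ τ⁻³ ≤ 2 (1 + τ²)⁻¹`). -/
theorem transformKernel_le {t τ : ℝ} (ht : 0 ≤ t) (hτ : 1 ≤ τ) :
    (τ - 1) / τ ^ 4 * Real.exp (-t / τ) ≤ 2 * (1 + τ ^ 2)⁻¹ := by
  have hτ0 : 0 < τ := by linarith
  have hexp : Real.exp (-t / τ) ≤ 1 :=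
    Real.exp_le_one_iff.2 (div_nonpos_of_nonpos_of_nonneg (neg_nonpos.2 ht) hτ0.le)
  have h1 : (τ - 1) / τ ^ 4 ≤ 2 * (1 + τ ^ 2)⁻¹ := by
    rw [← div_eq_mul_inv, div_le_div_iff₀ (by positivity) (by positivity)]
    have h3 : τ ^ 3 ≤ τ ^ 4 := pow_le_pow_right₀ hτ (by norm_num)
    have h4 : τ ≤ τ ^ 4 := le_self_pow₀ hτ (by norm_num)
    nlinarith [h3, h4, sq_nonneg τ]
  calc (τ - 1) / τ ^ 4 * Real.exp (-t / τ) ≤ (τ - 1) / τ ^ 4 * 1 :=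
        mul_le_mul_of_nonneg_left hexp (div_nonneg (by linarith) (by positivity))
    _ ≤ 2 * (1 + τ ^ 2)⁻¹ := by rw [mul_one]; exact h1

/-- For `t ≥ 0`, `τ ↦ κ(t, τ)` is integrable on `(1, ∞)` (comparison with `2 (1 + τ²)⁻¹`). -/
theorem transformKernel_integrableOn {t : ℝ} (ht : 0 ≤ t) :
    IntegrableOn (fun τ : ℝ ↦ (τ - 1) / τ ^ 4 * Real.exp (-t / τ)) (Ioi 1) := by
  refine Integrable.mono' ((integrable_inv_one_add_sq.const_mul 2).integrableOn) ?_ ?_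
  · exact (by fun_prop : Measurable fun τ : ℝ ↦ (τ - 1) / τ ^ 4 * Real.exp (-t / τ)).aestronglyMeasurable
  · filter_upwards [ae_restrict_mem measurableSet_Ioi] with τ hτ
    rw [Real.norm_eq_abs, abs_of_nonneg (transformKernel_nonneg t (mem_Ioi.1 hτ).le)]
    exact transformKernel_le ht (mem_Ioi.1 hτ).le

/-- For `T ≥ 1`: the finite kernel `k_T(t) = ∫₁^T κ(t, τ) dτ` is non-negative. -/
theorem transformKernelFin_nonneg (t : ℝ) {T : ℝ} (hT : 1 ≤ T) :
    0 ≤ ∫ τ in (1 : ℝ)..T, (τ - 1) / τ ^ 4 * Real.exp (-t / τ) :=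
  intervalIntegral.integral_nonneg hT fun _ hτ ↦ transformKernel_nonneg t hτ.1

/-- For `t ≥ 0` and `T ≥ 1`: `k_T(t) ≤ k(t) = ∫_{(1,∞)} κ(t, τ) dτ`. -/
theorem transformKernelFin_le {t : ℝ} (ht : 0 ≤ t) {T : ℝ} (hT : 1 ≤ T) :
    ∫ τ in (1 : ℝ)..T, (τ - 1) / τ ^ 4 * Real.exp (-t / τ) ≤
      ∫ τ in Ioi (1 : ℝ), (τ - 1) / τ ^ 4 * Real.exp (-t / τ) := by
  rw [intervalIntegral.integral_of_le hT]
  exact setIntegral_mono_set (transformKernel_integrableOn ht)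
    ((ae_restrict_mem measurableSet_Ioi).mono fun τ hτ ↦ transformKernel_nonneg t (mem_Ioi.1 hτ).le)
    Ioc_subset_Ioi_self.eventuallyLE

/-- For `t ≥ 0`: `k_T(t) → k(t)` as `T → ∞` (real filter). -/
theorem transformKernelFin_tendsto {t : ℝ} (ht : 0 ≤ t) :
    Tendsto (fun T : ℝ ↦ ∫ τ in (1 : ℝ)..T, (τ - 1) / τ ^ 4 * Real.exp (-t / τ)) atTop
      (𝓝 (∫ τ in Ioi (1 : ℝ), (τ - 1) / τ ^ 4 * Real.exp (-t / τ))) :=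
  intervalIntegral_tendsto_integral_Ioi 1 (transformKernel_integrableOn ht) tendsto_id

/-- **Stub 4 of line `Sketch`** (the monotone limit in the Wang–Wang density transform, arXiv:2308.06560
Prop. 2.6; pure measure theory): under the finite transform identity for every `T ≥ 1`, the regularised
asymptotic volume ratio `a = lim_{T→∞} (16π²T²)⁻¹ ∫ e^{-f/T} dμ ≥ 0` exists, `R·k(f)` is integrable for
`k(t) = ∫₁^∞ (τ − 1) τ⁻⁴ e^{-t/τ} dτ`, and `∫ e^{-f} dμ = 16π² a + ∫ R k(f) dμ`. -/
theorem stub_transformLimit : ∀ (X : Type) [TopologicalSpace X] [SecondCountableTopology X] [MeasurableSpace X] [BorelSpace X] (μ : MeasureTheory.Measure X) [MeasureTheory.SigmaFinite μ] (f R : X → ℝ), Continuous f → Continuous R → (∀ x, 0 ≤ f x) → (∀ x, 0 ≤ R x) → (∀ τ : ℝ, 0 < τ → MeasureTheory.Integrable (fun x ↦ Real.exp (-f x / τ)) μ ∧ MeasureTheory.Integrable (fun x ↦ f x * Real.exp (-f x / τ)) μ ∧ MeasureTheory.Integrable (fun x ↦ R x * Real.exp (-f x / τ)) μ) → (∀ T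 : ℝ, 1 ≤ T → MeasureTheory.Integrable (fun x ↦ R x * ∫ τ in (1 : ℝ)..T, (τ - 1) / τ ^ 4 * Real.exp (-f x / τ)) μ ∧ ∫ x, Real.exp (-f x) ∂μ = (T ^ 2)⁻¹ * (∫ x, Real.exp (-f x / T) ∂μ) + ∫ x, R x * (∫ τ in (1 : ℝ)..T, (τ - 1) / τ ^ 4 * Real.exp (-f x / τ)) ∂μ) → ∃ a : ℝ, 0 ≤ a ∧ Filter.Tendsto (fun T : ℝ ↦ (16 * Real.pi ^ 2 * T ^ 2)⁻¹ * ∫ x, Real.exp (-f x / T) ∂μ) Filter.atTop (nhds a) ∧ MeasureTheory.Integrable (fun x ↦ R x * ∫ τ in Set.Ioi (1 : ℝ), (τ - 1) / τ ^ 4 * Real.exp (-f x / τ)) μ ∧ ∫ x, Real.exp (-f x) ∂μ = 16 * Real.pi ^ 2 * a + ∫ x, R x * (∫ τ in Set.Ioi (1 : ℝ), (τ - 1) / τ ^ 4 * Real.exp (-f x / τ)) ∂μ := by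
  intro X _ _ _ _ μ _ f R _ _ hf0 hR0 _ Hfin
  -- (1) the core terms along `T = k + 1` are integrable with integral `≤ Z`
  have hT1 : ∀ k : ℕ, (1 : ℝ) ≤ (k : ℝ) + 1 := fun k ↦ by
    have : (0 : ℝ) ≤ k := k.cast_nonneg
    linarith
  have hum : ∀ k : ℕ, AEStronglyMeasurable
      (fun x ↦ R x * ∫ τ in (1 : ℝ)..((k : ℝ) + 1), (τ - 1) / τ ^ 4 * Real.exp (-f x / τ)) μ :=
    fun k ↦ (Hfin _ (hT1 k)).1.aestronglyMeasurable
  have hu0 : ∀ k : ℕ, 0 ≤ᵐ[μ]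
      (fun x ↦ R x * ∫ τ in (1 : ℝ)..((k : ℝ) + 1), (τ - 1) / τ ^ 4 * Real.exp (-f x / τ)) :=
    fun k ↦ Eventually.of_forall fun x ↦ mul_nonneg (hR0 x) (transformKernelFin_nonneg (f x) (hT1 k))
  have hseq : Tendsto (fun k : ℕ ↦ (k : ℝ) + 1) atTop atTop :=
    tendsto_atTop_add_const_right _ 1 tendsto_natCast_atTop_atTop
  have hlim : ∀ᵐ x ∂μ, Tendsto
      (fun k : ℕ ↦ R x * ∫ τ in (1 : ℝ)..((k : ℝ) + 1), (τ - 1) / τ ^ 4 * Real.exp (-f x / τ)) atTop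
      (𝓝 (R x * ∫ τ in Set.Ioi (1 : ℝ), (τ - 1) / τ ^ 4 * Real.exp (-f x / τ))) :=
    Eventually.of_forall fun x ↦ ((transformKernelFin_tendsto (hf0 x)).comp hseq).const_mul (R x)
  have hC : ∀ᶠ k : ℕ in atTop,
      Integrable (fun x ↦ R x * ∫ τ in (1 : ℝ)..((k : ℝ) + 1), (τ - 1) / τ ^ 4 * Real.exp (-f x / τ)) μ ∧
      ∫ x, R x * (∫ τ in (1 : ℝ)..((k : ℝ) + 1), (τ - 1) / τ ^ 4 * Real.exp (-f x / τ)) ∂μ ≤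
        ∫ x, Real.exp (-f x) ∂μ := by
    refine Eventually.of_forall fun k ↦ ⟨(Hfin _ (hT1 k)).1, ?_⟩
    have h2 := (Hfin _ (hT1 k)).2
    have h3 : 0 ≤ (((k : ℝ) + 1) ^ 2)⁻¹ * ∫ x, Real.exp (-f x / ((k : ℝ) + 1)) ∂μ :=
      mul_nonneg (inv_nonneg.2 (sq_nonneg _)) (integral_nonneg fun x ↦ (Real.exp_pos _).le)
    linarith
  -- (2) Fatou: `R k(f)` is integrable with `∫ R k(f) ≤ Z`
  obtain ⟨hgi, hgle⟩ := Literature.Analysis.FluidPDE.integrable_of_tendsto_of_integral_le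
    (v := fun x ↦ R x * ∫ τ in Set.Ioi (1 : ℝ), (τ - 1) / τ ^ 4 * Real.exp (-f x / τ)) hum hu0 hlim hC
  -- (3) dominated convergence along the real filter: `∫ R k_T(f) → ∫ R k(f)`
  have hG : Tendsto (fun T : ℝ ↦ ∫ x, R x * (∫ τ in (1 : ℝ)..T, (τ - 1) / τ ^ 4 * Real.exp (-f x / τ)) ∂μ)
      atTop (𝓝 (∫ x, R x * (∫ τ in Set.Ioi (1 : ℝ), (τ - 1) / τ ^ 4 * Real.exp (-f x / τ)) ∂μ)) := by
    refine tendsto_integral_filter_of_dominated_convergence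
      (fun x ↦ R x * ∫ τ in Set.Ioi (1 : ℝ), (τ - 1) / τ ^ 4 * Real.exp (-f x / τ)) ?_ ?_ hgi ?_
    · filter_upwards [eventually_ge_atTop (1 : ℝ)] with T hT
      exact (Hfin T hT).1.aestronglyMeasurable
    · filter_upwards [eventually_ge_atTop (1 : ℝ)] with T hT
      refine Eventually.of_forall fun x ↦ ?_
      rw [Real.norm_eq_abs, abs_of_nonneg (mul_nonneg (hR0 x) (transformKernelFin_nonneg (f x) hT))]
      exact mul_le_mul_of_nonneg_left (transformKernelFin_le (hf0 x) hT) (hR0 x)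
    · exact Eventually.of_forall fun x ↦ (transformKernelFin_tendsto (hf0 x)).const_mul (R x)
  -- (4) assembly
  have hpi : (16 * Real.pi ^ 2 : ℝ) ≠ 0 := by positivity
  have heq : ∀ T : ℝ, 1 ≤ T → (16 * Real.pi ^ 2 * T ^ 2)⁻¹ * ∫ x, Real.exp (-f x / T) ∂μ =
      (16 * Real.pi ^ 2)⁻¹ * (∫ x, Real.exp (-f x) ∂μ -
        ∫ x, R x * (∫ τ in (1 : ℝ)..T, (τ - 1) / τ ^ 4 * Real.exp (-f x / τ)) ∂μ) := by
    intro T hT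
    rw [(Hfin T hT).2, add_sub_cancel_right]
    ring
  refine ⟨(16 * Real.pi ^ 2)⁻¹ * (∫ x, Real.exp (-f x) ∂μ -
      ∫ x, R x * (∫ τ in Set.Ioi (1 : ℝ), (τ - 1) / τ ^ 4 * Real.exp (-f x / τ)) ∂μ), ?_, ?_, hgi, ?_⟩
  · exact mul_nonneg (by positivity) (sub_nonneg.2 hgle)
  · refine Tendsto.congr' ?_
      ((hG.const_sub (∫ x, Real.exp (-f x) ∂μ)).const_mul (16 * Real.pi ^ 2)⁻¹)
    filter_upwards [eventually_ge_atTop (1 : ℝ)] with T hT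
    exact (heq T hT).symm
  · rw [mul_inv_cancel_left₀ hpi, sub_add_cancel]

end Summit.SmoothPoincare4.SmoothPoincare4.Theorems.ConicalGapSketch

end
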